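import Summits.ResolutionOfSingularities.ResolutionOfSingularities.Theorems.WeightedInvariantHypersurfaceLocalGameEFT4S
import Summits.ResolutionOfSingularities.ResolutionOfSingularities.Theorems.WeightedInvariantHypersurfaceLocalGameEFTDimOne
import Summits.ResolutionOfSingularities.ResolutionOfSingularities.Theorems.WeightedInvariantIotaOrder
import HarnessLib

/-!
# The DIM-1 RUNG of the registered key H2a⁗-S `LocalWeightedDropEFT4S p` (door `HypersurfaceCentreConstruction`,
# stmt-ResolutionOfSingularities-19897), part 1: the canonical game clause (c9′) in Krull dimension one, for every
# iso-invariant `ι` and `J = 𝔪ᵐ`, and for the concrete pair `(iotaOrd, powers of the Jacobson radical)`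

Topic: `Summits/ResolutionOfSingularities/ResolutionOfSingularities/Theorems`. Helper for the door item
`HypersurfaceCentreConstruction` (stmt-ResolutionOfSingularities-19897, route `WeightedInvariant`), ORDER (o23) of the door
registrar res-L1-w43-plan-1 (2026-08-27T06:29:38Z): «BC5-type witness for H2a⁗-S itself, not only for EFT′ — for EACH of the
two position-dependent clauses of `LocalWeightedDropEFT4S p` prove its restriction to `ringKrullDim S = 1` for a CONCRETE pair
`(ι, J)`». Part 2 (`…LocalGameEFT4SDimOne.lean`) does the ∀-model open presentation (open″). [OURS · L1 W4.3] Replaces the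
role of NO printed item; NOT a statement of the manuscript [claim: Hironaka2017, status: under-review]. AI work, weaker than
expert review.

## What is proved (def-free)

`(ι, J)` is ANY pair with `ι` invariant under ring isomorphisms (clause (c6) `IotaIsoInvariant`) and `J` equal to the powers of
the maximal ideal on local rings (`∀ R local, J R g m = 𝔪_R ^ m`); the CONCRETE pair of the order is
`(iotaOrd, fun R _ _ m => (Ideal.jacobson ⊥ : Ideal R) ^ m)` (the tree's order function `…IotaOrder` p500698, and the powers of
the Jacobson radical — on a local ring the maximal ideal), for which the two hypotheses are discharged
(`iotaOrd_isoInvariant`; `IsLocalRing.jacobson_eq_maximalIdeal`, `jacobson_bot_pow_eq`).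

* `canonicalGameClause_dimOne` — the body of (c9′) `CanonicalGameClause p ι J` at every regular local `S` of Krull dimension
  `1` (a DVR, Matsumura 11.2) and `0 ≠ f ∈ 𝔪²`: centre `P = 𝔪_S` (`S ⧸ 𝔪` a field, regular); (strat)/(loc) — a prime containing
  `f ≠ 0` is `𝔪` (dimension ≤ 1), `S ≃ S_𝔪` carries `ι` (`iota_localization_maximalIdeal_eq`), `J` localises tautologically;
  (pres) the move `u = (ϖ)`, `w = (1)` of p499453 with `(u_i : w_i > 0) = (ϖ) = 𝔪` and
  `weightedMonomialIdeal (ϖ) (1) m = (ϖᵐ) = 𝔪ᵐ = J S f m` (`weightedMonomialIdeal_one_eq`); (adm) and the VACUOUS successor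
  clause exactly as in p499453 (`localGameEFT_clause_of_ringKrullDim_eq_one`: in `B = S[t⁻¹, ϖ t]`, `f = υ ϖᵐ = (t⁻¹)ᵃ g` with
  `t⁻¹ ∤ g` forces `a = m`, `g = υ (ϖ t)ᵐ`, a unit off the vertex — the argument is re-run for the explicit move, since the
  ∃-statement of p499453 hides `(u, w)`, which (c9′) pins through `weightedMonomialIdeal u w = J S f`).
* `canonicalGameClause_dimOne_iotaOrd` — the same for the concrete pair.

## References

* J. Włodarczyk, *Functorial resolution by torus actions*, arXiv:2203.03090, Def. 2.3.5 (full cobordant blow-up, vertex).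
  [Wlodarczyk2022]
* H. Matsumura, *Commutative Ring Theory*, Thm. 11.2 (regular local of dimension one = DVR). [Matsumura1987]
-/

noncomputable section

open IsLocalRing Literature.AlgebraicGeometry.Resolution
open LaurentPolynomial
open scoped LaurentPolynomial
open Summit.ResolutionOfSingularities.ResolutionOfSingularities.Cruxes.HypersurfaceCentreConstruction.LocalEngine

set_option linter.dupNamespace false -- mandated namespace of this single-conjunct summit

namespace Summit.ResolutionOfSingularities.ResolutionOfSingularities.Theorems

namespace LocalGameEFT4SDimOne

variable {S : Type} [CommRing S]

/-- For the one-element chart `u = (ϖ)`, `w = (1)`, the weighted monomial ideal of degree `m` IS `(ϖᵐ)`. [folklore] -/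
theorem weightedMonomialIdeal_one_eq (ϖ : S) (m : ℕ) :
    weightedMonomialIdeal (fun _ : Fin 1 => ϖ) (fun _ => 1) m = Ideal.span {ϖ ^ m} := by
  refine le_antisymm (LocalGameEFTDimOne.weightedMonomialIdeal_one_le ϖ m) ?_
  rw [Ideal.span_singleton_le_iff_mem]
  simpa using LocalGameEFTDimOne.mul_pow_mem_weightedMonomialIdeal_one ϖ 1 (le_refl m)

/-- For the one-element chart `u = (ϖ)`, `w = (1)`, the positively weighted members span `(ϖ)`. [folklore] -/
theorem span_posWeight_one_eq (ϖ : S) :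
    Ideal.span {x : S | ∃ i : Fin 1, 0 < (fun _ : Fin 1 => (1 : ℕ)) i ∧ x = (fun _ : Fin 1 => ϖ) i} =
      Ideal.span {ϖ} := by
  congr 1
  ext x
  rw [Set.mem_setOf_eq, Set.mem_singleton_iff]
  exact ⟨fun ⟨_, _, hx⟩ => hx, fun hx => ⟨0, Nat.one_pos, hx⟩⟩

/-- In a local ring, the complement of the maximal ideal consists of units, so `S → S_𝔪` is an isomorphism; an
iso-invariant class function takes the same value on `f` and on its image in `S_𝔪`. [folklore] -/
theorem iota_localization_maximalIdeal_eq [IsLocalRing S]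
    (ι : (R : Type) → [CommRing R] → R → Ordinal.{0}) (hι : IotaIsoInvariant ι) (f : S) :
    ι (Localization.AtPrime (maximalIdeal S)) (algebraMap S (Localization.AtPrime (maximalIdeal S)) f) = ι S f := by
  have hunits : (maximalIdeal S).primeCompl ≤ IsUnit.submonoid S := by
    intro x hx
    rw [IsUnit.mem_submonoid_iff]
    by_contra hnu
    exact hx ((IsLocalRing.mem_maximalIdeal x).mpr (mem_nonunits_iff.mpr hnu))
  let e : S ≃ₐ[S] Localization.AtPrime (maximalIdeal S) :=
    IsLocalization.atUnits S (maximalIdeal S).primeCompl hunits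
  have he : e f = algebraMap S (Localization.AtPrime (maximalIdeal S)) f := by
    simpa using e.commutes f
  rw [← he]
  exact hι S (Localization.AtPrime (maximalIdeal S)) e.toRingEquiv f

/-- The `J` of the rung localises tautologically at the maximal ideal: `J(S_𝔪)(f) m = (J S f m)·S_𝔪` for `J = 𝔪ᵐ`. [folklore] -/
theorem J_localization_maximalIdeal_eq [IsLocalRing S]
    (J : (R : Type) → [CommRing R] → R → ℕ → Ideal R)
    (hJ : ∀ (R : Type) [CommRing R] [IsLocalRing R] (g : R) (m : ℕ), J R g m = (maximalIdeal R) ^ m) (f : S) (m : ℕ) :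
    J (Localization.AtPrime (maximalIdeal S)) (algebraMap S (Localization.AtPrime (maximalIdeal S)) f) m =
      (J S f m).map (algebraMap S (Localization.AtPrime (maximalIdeal S))) := by
  rw [hJ, hJ, Ideal.map_pow, Localization.AtPrime.map_eq_maximalIdeal]

end LocalGameEFT4SDimOne

open LocalGameEFT4SDimOne

/-! ## (a) The canonical game clause (c9′) in Krull dimension one -/

/-- **(c9′) `CanonicalGameClause` in Krull dimension one** — for every iso-invariant `ι` and every `J` that is `𝔪ᵐ` on local
rings. At a regular local `S` with `ringKrullDim S = 1` (a DVR) and `0 ≠ f ∈ 𝔪²`: centre `P = 𝔪_S`; (strat)/(loc) over the one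
prime `𝔪` containing `f`; the move `u = (ϖ)`, `w = (1)` presents `J S f m = 𝔪ᵐ = (ϖᵐ)`; admissibility; and the successor
clause holds VACUOUSLY (p499453's argument for this explicit move: `f = υ ϖᵐ = (t⁻¹)ᵃ g` with `t⁻¹ ∤ g` forces `g = υ (ϖ t)ᵐ`,
a unit off the vertex, so `g ∉ 𝔪_{B_𝔫}²`). [OURS · L1 W4.3 · (o23)(a) dim-1 rung of H2a⁗-S] -/
theorem canonicalGameClause_dimOne
    (ι : (R : Type) → [CommRing R] → R → Ordinal.{0}) (hι : IotaIsoInvariant ι)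
    (J : (R : Type) → [CommRing R] → R → ℕ → Ideal R)
    (hJ : ∀ (R : Type) [CommRing R] [IsLocalRing R] (g : R) (m : ℕ), J R g m = (maximalIdeal R) ^ m)
    (S : Type) [CommRing S] [IsRegularLocalRing S] (hdim : ringKrullDim S = 1)
    (f : S) (hf0 : f ≠ 0) (hf2 : f ∈ (maximalIdeal S) ^ 2) :
    ∃ (P : Ideal S), P.IsPrime ∧ IsRegularLocalRing (S ⧸ P) ∧ f ∈ P ∧
      (∀ (𝔭 : Ideal S) [𝔭.IsPrime], f ∈ 𝔭 →
        (ι (Localization.AtPrime 𝔭) (algebraMap S (Localization.AtPrime 𝔭) f) = ι S f ↔ P ≤ 𝔭)) ∧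
      (∀ (𝔭 : Ideal S) [𝔭.IsPrime], f ∈ 𝔭 → P ≤ 𝔭 → ∀ m : ℕ,
        J (Localization.AtPrime 𝔭) (algebraMap S (Localization.AtPrime 𝔭) f) m =
          (J S f m).map (algebraMap S (Localization.AtPrime 𝔭))) ∧
      ∃ (n : ℕ) (u : Fin n → S) (w : Fin n → ℕ),
        Ideal.span (Set.range u) = maximalIdeal S ∧ (maximalIdeal S).spanFinrank = n ∧ (∃ i, 0 < w i) ∧
        Ideal.span {x | ∃ i, 0 < w i ∧ x = u i} = P ∧
        (∀ m : ℕ, weightedMonomialIdeal u w m = J S f m) ∧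
        (∀ (Q : Ideal S) [Q.IsPrime], P ≤ Q →
          algebraMap S (Localization.AtPrime Q) f ∈ (maximalIdeal (Localization.AtPrime Q)) ^ 2) ∧
        ∀ (𝔫 : Ideal (cobordantAlgebra' u w)) [𝔫.IsPrime],
          cobordantT' u w ∈ 𝔫 →
          P.map (algebraMap S (cobordantAlgebra' u w)) ≤ 𝔫 →
          ¬ (extReesAlgebra.vertexIdeal (weightedMonomialIdeal u w) ≤ 𝔫) →
          ∀ (a : ℕ) (g : cobordantAlgebra' u w),
            algebraMap S (cobordantAlgebra' u w) f = cobordantT' u w ^ a * g →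
            ¬ (cobordantT' u w ∣ g) →
            algebraMap (cobordantAlgebra' u w) (Localization.AtPrime 𝔫) g ∈
              (maximalIdeal (Localization.AtPrime 𝔫)) ^ 2 →
            ι (Localization.AtPrime 𝔫) (algebraMap (cobordantAlgebra' u w) (Localization.AtPrime 𝔫) g) < ι S f := by
  classical
  -- `S` is a discrete valuation ring: uniformiser, factorisation `f = υ ϖᵐ`
  haveI := isDomain_of_isRegularLocalRing S
  haveI : IsDiscreteValuationRing S :=
    Literature.RingTheory.RegularLocalRing.isDiscreteValuationRing_of_ringKrullDim_eq_one hdim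
  obtain ⟨ϖ, hirr⟩ := IsDiscreteValuationRing.exists_irreducible S
  have h𝔪 : maximalIdeal S = Ideal.span {ϖ} :=
    (IsDiscreteValuationRing.irreducible_iff_uniformizer ϖ).mp hirr
  obtain ⟨m, υ, hfυ⟩ := IsDiscreteValuationRing.eq_unit_mul_pow_irreducible hf0 hirr
  -- a prime containing `f ≠ 0` is the maximal ideal (dimension ≤ 1)
  have hprime : ∀ (𝔭 : Ideal S) [𝔭.IsPrime], f ∈ 𝔭 → 𝔭 = maximalIdeal S := by
    intro 𝔭 _ hf𝔭
    have hne : 𝔭 ≠ ⊥ := by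
      rintro rfl
      exact hf0 (Ideal.mem_bot.mp hf𝔭)
    exact IsLocalRing.eq_maximalIdeal (Ring.DimensionLEOne.maximalOfPrime hne inferInstance)
  refine ⟨maximalIdeal S, inferInstance, ?_, Ideal.pow_le_self two_ne_zero hf2, ?_, ?_, ?_⟩
  · -- `S ⧸ 𝔪` is a field, hence regular
    have hF : IsField (S ⧸ maximalIdeal S) :=
      (Ideal.Quotient.maximal_ideal_iff_isField_quotient (maximalIdeal S)).mp inferInstance
    letI := hF.toField
    infer_instance
  · -- (strat)
    intro 𝔭 _ hf𝔭
    have h𝔭 := hprime 𝔭 hf𝔭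
    subst h𝔭
    exact ⟨fun _ => le_rfl, fun _ => iota_localization_maximalIdeal_eq ι hι f⟩
  · -- (loc)
    intro 𝔭 _ hf𝔭 _ m'
    have h𝔭 := hprime 𝔭 hf𝔭
    subst h𝔭
    exact J_localization_maximalIdeal_eq J hJ f m'
  · -- (pres) + (adm) + (drop), explicit move `u = (ϖ)`, `w = (1)`
    set u : Fin 1 → S := fun _ => ϖ with hu
    set w : Fin 1 → ℕ := fun _ => 1 with hw
    refine ⟨1, u, w, ?_, ?_, ⟨0, Nat.one_pos⟩, ?_, ?_, ?_, ?_⟩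
    · -- `(ϖ) = 𝔪`
      rw [hu, Set.range_const, h𝔪]
    · -- embedding dimension one
      have h := IsRegularLocalRing.spanFinrank_maximalIdeal (R := S)
      rw [hdim] at h
      exact_mod_cast h
    · -- the positively weighted members span the centre `𝔪`
      rw [hu, hw, span_posWeight_one_eq, h𝔪]
    · -- the CANONICAL filtration: `weightedMonomialIdeal (ϖ) (1) m = (ϖᵐ) = 𝔪ᵐ = J S f m`
      intro m'
      rw [hJ, h𝔪, Ideal.span_singleton_pow, hu, hw, weightedMonomialIdeal_one_eq]
    · -- admissibility: a prime containing `𝔪` is `𝔪`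
      intro Q _ hQ
      have hfQ : f ∈ Q ^ 2 := Ideal.pow_right_mono hQ 2 hf2
      have := Ideal.mem_map_of_mem (algebraMap S (Localization.AtPrime Q)) hfQ
      rwa [Ideal.map_pow, Localization.AtPrime.map_eq_maximalIdeal] at this
    · -- successor clause: vacuous (p499453's argument for the explicit move)
      intro 𝔫 _ _ _ hV a g hfg hndvd hg2
      exfalso
      -- the generator `ϖ t` of `B = S[t⁻¹, ϖ t]`
      have hϖI : ϖ ∈ weightedMonomialIdeal u w 1 := by
        simpa [hu, hw] using LocalGameEFTDimOne.mul_pow_mem_weightedMonomialIdeal_one ϖ 1 (le_refl 1)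
      let ϖT : extReesAlgebra (weightedMonomialIdeal u w) :=
        ⟨C ϖ * T ((1 : ℕ) : ℤ), extReesAlgebra.C_mul_T_mem _ Nat.one_pos hϖI⟩
      -- `g = C(f) tᵃ`
      have hgval : (g : S[T;T⁻¹]) = C f * T (a : ℤ) := LocalGameEFTDimOne.coe_eq_C_mul_T_of_eq hfg
      -- the `tᵃ`-coefficient `f` of `g` lies in `𝒥ₐ ⊆ (ϖᵃ)`, so `a ≤ m`
      have hcoeff : (g : S[T;T⁻¹]).coeff (a : ℤ) = f := by
        rw [hgval, ← single_eq_C_mul_T, AddMonoidAlgebra.coeff_single, Finsupp.single_eq_same]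
      have hfa : f ∈ Ideal.span {ϖ ^ a} := by
        have h := InitialIdeal.coeff_mem_weightedMonomialIdeal u w g a
        rw [hcoeff] at h
        exact LocalGameEFTDimOne.weightedMonomialIdeal_one_le ϖ a (by simpa [hu, hw] using h)
      have ham : a ≤ m := by
        rw [Ideal.mem_span_singleton, hfυ, Units.dvd_mul_left] at hfa
        exact (pow_dvd_pow_iff hirr.ne_zero hirr.not_isUnit).mp hfa
      -- `a < m` would make `g` divisible by `t⁻¹`
      have hma : ¬ a < m := by
        intro hlt
        apply hndvd
        have hfI : f ∈ weightedMonomialIdeal u w (a + 1) := by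
          rw [hfυ]
          simpa [hu, hw] using LocalGameEFTDimOne.mul_pow_mem_weightedMonomialIdeal_one ϖ (υ : S) hlt
        refine ⟨⟨C f * T ((a + 1 : ℕ) : ℤ), extReesAlgebra.C_mul_T_mem _ (Nat.succ_pos a) hfI⟩,
          Subtype.ext ?_⟩
        rw [MulMemClass.coe_mul, extReesAlgebra.coe_tInv, hgval, mul_left_comm, ← T_add]
        congr 2
        push_cast
        ring
      have hameq : a = m := le_antisymm ham (not_lt.mp hma)
      -- hence `g = υ (ϖ t)ᵐ`
      have hgeq : g = algebraMap S (extReesAlgebra (weightedMonomialIdeal u w)) (υ : S) * ϖT ^ m := by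
        apply Subtype.ext
        rw [hgval, hameq, hfυ, MulMemClass.coe_mul, SubmonoidClass.coe_pow, Subalgebra.coe_algebraMap,
          ← C_eq_algebraMap, map_mul, map_pow, mul_pow, ← map_pow, T_pow, mul_assoc]
        congr 3
        push_cast
        ring
      -- the vertex ideal lies in `(ϖ t)`, so `ϖ t ∉ 𝔫`
      have hE : extReesAlgebra (weightedMonomialIdeal u w) = cobordantAlgebra u w :=
        stub_extReesAlgebra_weighted u w
      have hVle : extReesAlgebra.vertexIdeal (weightedMonomialIdeal u w) ≤ Ideal.span {ϖT} := by
        have h := vertexIdeal_le_span_u' u w hE (fun _ : Fin 1 => ϖT) (fun _ => rfl) (fun _ => rfl)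
        rwa [Set.range_const] at h
      have hϖT𝔫 : ϖT ∉ 𝔫 := fun hmem =>
        hV (hVle.trans ((Ideal.span_singleton_le_iff_mem _).mpr hmem))
      -- so `g` is a unit at `𝔫`, contradicting `g ∈ 𝔪_{B_𝔫}²`
      have hunit : IsUnit (algebraMap (extReesAlgebra (weightedMonomialIdeal u w))
          (Localization.AtPrime 𝔫) g) := by
        rw [hgeq, map_mul, map_pow]
        refine IsUnit.mul ((υ.isUnit.map _).map _) (IsUnit.pow m ?_)
        exact IsLocalization.map_units (Localization.AtPrime 𝔫) (⟨ϖT, hϖT𝔫⟩ : 𝔫.primeCompl)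
      have hmem : algebraMap (extReesAlgebra (weightedMonomialIdeal u w)) (Localization.AtPrime 𝔫) g ∈
          maximalIdeal (Localization.AtPrime 𝔫) := Ideal.pow_le_self two_ne_zero hg2
      exact (mem_nonunits_iff.mp ((IsLocalRing.mem_maximalIdeal _).mp hmem)) hunit

/-! ## (c) The concrete pair `(iotaOrd, powers of the Jacobson radical)` -/

/-- On a local ring the powers of the Jacobson radical are the powers of the maximal ideal. [folklore] -/
theorem jacobson_bot_pow_eq (R : Type) [CommRing R] [IsLocalRing R] (_g : R) (m : ℕ) :
    (Ideal.jacobson (⊥ : Ideal R)) ^ m = (maximalIdeal R) ^ m := by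
  rw [IsLocalRing.jacobson_eq_maximalIdeal ⊥ bot_ne_top]

/-- **(o23)(a) for the concrete pair** `(ι, J) = (iotaOrd, m ↦ (Jacobson radical)ᵐ)`: the (c9′) canonical game clause at every
regular local ring of Krull dimension `1`. [OURS · L1 W4.3 · (o23)(a)] -/
theorem canonicalGameClause_dimOne_iotaOrd
    (S : Type) [CommRing S] [IsRegularLocalRing S] (hdim : ringKrullDim S = 1)
    (f : S) (hf0 : f ≠ 0) (hf2 : f ∈ (maximalIdeal S) ^ 2) :
    ∃ (P : Ideal S), P.IsPrime ∧ IsRegularLocalRing (S ⧸ P) ∧ f ∈ P ∧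
      (∀ (𝔭 : Ideal S) [𝔭.IsPrime], f ∈ 𝔭 →
        (iotaOrd (Localization.AtPrime 𝔭) (algebraMap S (Localization.AtPrime 𝔭) f) = iotaOrd S f ↔ P ≤ 𝔭)) ∧
      (∀ (𝔭 : Ideal S) [𝔭.IsPrime], f ∈ 𝔭 → P ≤ 𝔭 → ∀ m : ℕ,
        (Ideal.jacobson (⊥ : Ideal (Localization.AtPrime 𝔭))) ^ m =
          ((Ideal.jacobson (⊥ : Ideal S)) ^ m).map (algebraMap S (Localization.AtPrime 𝔭))) ∧
      ∃ (n : ℕ) (u : Fin n → S) (w : Fin n → ℕ),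
        Ideal.span (Set.range u) = maximalIdeal S ∧ (maximalIdeal S).spanFinrank = n ∧ (∃ i, 0 < w i) ∧
        Ideal.span {x | ∃ i, 0 < w i ∧ x = u i} = P ∧
        (∀ m : ℕ, weightedMonomialIdeal u w m = (Ideal.jacobson (⊥ : Ideal S)) ^ m) ∧
        (∀ (Q : Ideal S) [Q.IsPrime], P ≤ Q →
          algebraMap S (Localization.AtPrime Q) f ∈ (maximalIdeal (Localization.AtPrime Q)) ^ 2) ∧
        ∀ (𝔫 : Ideal (cobordantAlgebra' u w)) [𝔫.IsPrime],
          cobordantT' u w ∈ 𝔫 →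
          P.map (algebraMap S (cobordantAlgebra' u w)) ≤ 𝔫 →
          ¬ (extReesAlgebra.vertexIdeal (weightedMonomialIdeal u w) ≤ 𝔫) →
          ∀ (a : ℕ) (g : cobordantAlgebra' u w),
            algebraMap S (cobordantAlgebra' u w) f = cobordantT' u w ^ a * g →
            ¬ (cobordantT' u w ∣ g) →
            algebraMap (cobordantAlgebra' u w) (Localization.AtPrime 𝔫) g ∈
              (maximalIdeal (Localization.AtPrime 𝔫)) ^ 2 →
            iotaOrd (Localization.AtPrime 𝔫) (algebraMap (cobordantAlgebra' u w) (Localization.AtPrime 𝔫) g) <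
              iotaOrd S f :=
  canonicalGameClause_dimOne iotaOrd iotaOrd_isoInvariant (fun R _ _ m => (Ideal.jacobson (⊥ : Ideal R)) ^ m)
    jacobson_bot_pow_eq S hdim f hf0 hf2

end Summit.ResolutionOfSingularities.ResolutionOfSingularities.Theorems

end
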